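import Literature.Geometry.Riemannian.BakryEmeryHeatFlow
import HarnessLib

/-!
# From positive densities to `w²` in the entropy–energy inequality EE(3,4)
(stub `stub_entropyEnergy_of_positive` = B3b of line `curvature-dimension-entropy-floor`, crux
`EntropyRung.SubcylindricalExistence`, item stmt-SmoothPoincare4-10871)

On a closed connected Riemannian `4`-manifold `(M, g)` (Levi-Civita connection) write
`Vol = Vol(M, g)`, `dm = dV/Vol`. The curvature–dimension entropy–energy inequality of
Bakry–Émery `Γ₂`-calculus in the POSITIVE-density form says: if `Ric ≥ K g`, `K > 0`, then for
every smooth `φ` with `∫ e^φ dV = Vol`,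
`(1/Vol) ∫ φ e^φ dV ≤ 2 log (1 + ∫ |∇φ|² e^φ dV / (4K Vol))`.
This file proves that this statement (taken as a hypothesis, it is the neighbouring stub B3a)
implies the `w²`-form EE(3,4) used by Theorem A of the line: if `Ric ≥ 3 g`, then for every smooth
`w` with `∫ w² dV = Vol`,
`(1/Vol) ∫ w² log w² dV ≤ 2 log (1 + ∫ |∇w|² dV / (3 Vol))`.

The proof is the standard regularisation. For `ε > 0` put `ρ_ε = (w² + ε)/(1 + ε) > 0` and
`φ_ε = log ρ_ε` (smooth, `∫ e^{φ_ε} dV = Vol`). The hypothesis at `K = 3` gives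
`(1/Vol) ∫ ρ_ε log ρ_ε dV ≤ 2 log (1 + ∫ |∇φ_ε|² e^{φ_ε} dV / (12 Vol))`, and the chain rule
(`gradSq_real_comp`, `gradSq_sq_add_const`) gives
`|∇φ_ε|² e^{φ_ε} = 4 w² |∇w|² / ((w² + ε)(1 + ε)) ≤ 4 |∇w|²`, so the right-hand side is at most
`2 log (1 + ∫ |∇w|² dV / (3 Vol))`, uniformly in `ε`. As `ε = 1/(n+1) → 0`,
`∫ ρ_ε log ρ_ε dV → ∫ w² log w² dV` by dominated convergence (`x log x` is bounded on the
bounded range `[0, sup w² + 1]` of the `ρ_ε`, the measure is finite), and the inequality passes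
to the limit.

* `tendsto_integral_regularised_mul_log` — the dominated-convergence step, for any finite measure
  and any measurable `0 ≤ u ≤ S`;
* `entropyEnergy_regularised` — the inequality for `ρ_ε`, `ε > 0` fixed;
* `stub_entropyEnergy_of_positive` — the registered stub.

Everything is proved; no definition, no named fact.

References: D. Bakry, I. Gentil, M. Ledoux, *Analysis and geometry of Markov diffusion
operators* (2014), §6; D. Bakry, F. Bolley, I. Gentil, arXiv:1412.5165, §4.1, eq. (4.1).
-/

noncomputable section

-- the registered namespace `Summit.SmoothPoincare4.SmoothPoincare4.Theorems` repeats a component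
set_option linter.dupNamespace false

open Bundle Set Function Filter Module MeasureTheory
open scoped Manifold ContDiff Topology ENNReal

namespace Summit.SmoothPoincare4.SmoothPoincare4.Theorems

open Literature.Geometry Literature.Geometry.Lorentzian Literature.Geometry.Riemannian
  Literature.Geometry.Lorentzian.PseudoRiemannianMetric

/-! ## The real-variable and measure-theoretic part -/

/-- `t log t` is bounded on every interval `[0, T]` (it is continuous there). [folklore] -/
theorem exists_bound_mul_log (T : ℝ) : ∃ C : ℝ, ∀ t ∈ Icc 0 T, |t * Real.log t| ≤ C := by
  obtain ⟨C, hC⟩ := (isCompact_Icc (a := (0 : ℝ)) (b := T)).exists_bound_of_continuousOn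
    (Real.continuous_mul_log.continuousOn (s := Icc 0 T))
  exact ⟨C, fun t ht ↦ by simpa [Real.norm_eq_abs] using hC t ht⟩

/-- The regularised densities stay in a fixed interval: `0 ≤ (u + ε)/(1 + ε) ≤ S + 1` for
`0 ≤ u ≤ S` and `0 < ε` (a convex combination of `u` and `1`). [folklore] -/
theorem regularised_mem_Icc {u S ε : ℝ} (hu0 : 0 ≤ u) (huS : u ≤ S) (hε : 0 < ε) :
    (u + ε) / (1 + ε) ∈ Icc 0 (S + 1) := by
  refine ⟨by positivity, ?_⟩
  rw [div_le_iff₀ (by linarith)]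
  nlinarith

/-- **Dominated convergence for the regularised entropies.** For a finite measure `μ`, a
measurable `u` with `0 ≤ u ≤ S`, and `ρ_n = (u + ε_n)/(1 + ε_n)`, `ε_n = 1/(n+1)`:
`∫ ρ_n log ρ_n dμ → ∫ u log u dμ` (`ρ_n → u` pointwise, `x log x` continuous, and
`|ρ_n log ρ_n| ≤ C(S)` uniformly since `0 ≤ ρ_n ≤ S + 1`). [folklore] -/
theorem tendsto_integral_regularised_mul_log {α : Type*} [MeasurableSpace α] (μ : Measure α)
    [IsFiniteMeasure μ] {u : α → ℝ} (hu : AEStronglyMeasurable u μ) (hu0 : ∀ x, 0 ≤ u x)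
    {S : ℝ} (huS : ∀ x, u x ≤ S) :
    Tendsto (fun n : ℕ ↦ ∫ x, (u x + 1 / ((n : ℝ) + 1)) / (1 + 1 / ((n : ℝ) + 1)) *
        Real.log ((u x + 1 / ((n : ℝ) + 1)) / (1 + 1 / ((n : ℝ) + 1))) ∂μ)
      atTop (𝓝 (∫ x, u x * Real.log (u x) ∂μ)) := by
  obtain ⟨C, hC⟩ := exists_bound_mul_log (S + 1)
  have hε : ∀ n : ℕ, 0 < 1 / ((n : ℝ) + 1) := fun n ↦ Nat.one_div_pos_of_nat
  refine tendsto_integral_of_dominated_convergence (fun _ ↦ C) (fun n ↦ ?_) (integrable_const C)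
    (fun n ↦ ae_of_all _ fun x ↦ ?_) (ae_of_all _ fun x ↦ ?_)
  · -- measurability: a continuous function of `u`
    have hc : Continuous fun t : ℝ ↦ (t + 1 / ((n : ℝ) + 1)) / (1 + 1 / ((n : ℝ) + 1)) *
        Real.log ((t + 1 / ((n : ℝ) + 1)) / (1 + 1 / ((n : ℝ) + 1))) :=
      Real.continuous_mul_log.comp ((continuous_id.add continuous_const).div_const _)
    exact hc.comp_aestronglyMeasurable hu
  · -- the uniform bound
    rw [Real.norm_eq_abs]
    exact hC _ (regularised_mem_Icc (hu0 x) (huS x) (hε n))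
  · -- the pointwise limit
    have h0 : Tendsto (fun n : ℕ ↦ 1 / ((n : ℝ) + 1)) atTop (𝓝 0) :=
      tendsto_one_div_add_atTop_nhds_zero_nat
    have h1 : Tendsto (fun n : ℕ ↦ (u x + 1 / ((n : ℝ) + 1)) / (1 + 1 / ((n : ℝ) + 1))) atTop
        (𝓝 (u x)) := by
      have h2 : Tendsto (fun n : ℕ ↦ (u x + 1 / ((n : ℝ) + 1)) / (1 + 1 / ((n : ℝ) + 1))) atTop
          (𝓝 ((u x + 0) / (1 + 0))) :=
        ((tendsto_const_nhds (x := u x)).add h0).div ((tendsto_const_nhds (x := (1 : ℝ))).add h0)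
          (by norm_num)
      simpa using h2
    exact (Real.continuous_mul_log.tendsto _).comp h1

/-! ## The regularised inequality on the manifold -/

/-- **EE(3,4) for the regularised densities `ρ_ε = (w² + ε)/(1 + ε)`.** On a closed connected
Riemannian `4`-manifold with `Ric ≥ 3g`, assume the positive-density entropy–energy inequality
(hypothesis `hEE`: for `Ric ≥ K g`, `K > 0`, smooth `φ` with `∫ e^φ dV = Vol`,
`(1/Vol)∫ φ e^φ dV ≤ 2 log (1 + ∫|∇φ|² e^φ dV/(4K Vol))`). Then for smooth `w` with `∫ w² dV = Vol`
and every `ε > 0`: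
`(1/Vol) ∫ ρ_ε log ρ_ε dV ≤ 2 log (1 + ∫ |∇w|² dV / (3 Vol))`.
Proof: `φ_ε = log ρ_ε` is smooth with `∫ e^{φ_ε} = Vol`; apply `hEE` at `K = 3`; by the chain rule
`|∇φ_ε|² e^{φ_ε} = 4w²|∇w|²/((w² + ε)(1 + ε)) ≤ 4|∇w|²`, and `log` is monotone. [folklore] -/
theorem entropyEnergy_regularised
    (hEE : ∀ (M : Type) [TopologicalSpace M] [T2Space M] [SecondCountableTopology M]
      [ChartedSpace (EuclideanSpace ℝ (Fin 4)) M] [IsManifold (𝓡 4) ∞ M] [CompactSpace M] [T3Space M]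
      [MeasurableSpace M] [BorelSpace M] [ConnectedSpace M]
      (g : PseudoRiemannianMetric (𝓡 4) ∞ (EuclideanSpace ℝ (Fin 4)) (TangentSpace (𝓡 4) : M → Type _))
      [g.HasLeviCivita] (_hg : g.IsRiemannian) (K : ℝ), 0 < K →
      (∀ (y : M) (X : TangentSpace (𝓡 4) y), K * g.val y X X ≤ g.ricci y X X) →
      ∀ φ : M → ℝ, ContMDiff (𝓡 4) 𝓘(ℝ, ℝ) ∞ φ →
        ∫ x, Real.exp (φ x) ∂g.riemVolume = (g.riemVolume Set.univ).toReal →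
        (∫ x, φ x * Real.exp (φ x) ∂g.riemVolume) / (g.riemVolume Set.univ).toReal ≤
          2 * Real.log (1 + (∫ x, g.gradSq φ x * Real.exp (φ x) ∂g.riemVolume)
            / (4 * K * (g.riemVolume Set.univ).toReal)))
    (M : Type) [TopologicalSpace M] [T2Space M] [SecondCountableTopology M]
    [ChartedSpace (EuclideanSpace ℝ (Fin 4)) M] [IsManifold (𝓡 4) ∞ M] [CompactSpace M] [T3Space M]
    [MeasurableSpace M] [BorelSpace M] [ConnectedSpace M]
    (g : PseudoRiemannianMetric (𝓡 4) ∞ (EuclideanSpace ℝ (Fin 4)) (TangentSpace (𝓡 4) : M → Type _))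
    [g.HasLeviCivita] (hg : g.IsRiemannian)
    (hRic : ∀ (x : M) (v : TangentSpace (𝓡 4) x), 3 * g.val x v v ≤ g.ricci x v v)
    (w : M → ℝ) (hw : ContMDiff (𝓡 4) 𝓘(ℝ, ℝ) ∞ w)
    (hmass : ∫ x, w x ^ 2 ∂(riemannianMeasure (g.toContMDiffRiemannianMetric hg))
      = (riemannianMeasure (g.toContMDiffRiemannianMetric hg) Set.univ).toReal)
    {ε : ℝ} (hε : 0 < ε) :
    (∫ x, (w x ^ 2 + ε) / (1 + ε) * Real.log ((w x ^ 2 + ε) / (1 + ε))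
        ∂(riemannianMeasure (g.toContMDiffRiemannianMetric hg)))
      / (riemannianMeasure (g.toContMDiffRiemannianMetric hg) Set.univ).toReal ≤
    2 * Real.log (1 + (∫ x, g.gradSq w x ∂(riemannianMeasure (g.toContMDiffRiemannianMetric hg)))
        / (3 * (riemannianMeasure (g.toContMDiffRiemannianMetric hg) Set.univ).toReal)) := by
  -- work with `g.riemVolume`, the currency of the hypothesis
  have hV : g.riemVolume = riemannianMeasure (g.toContMDiffRiemannianMetric hg) :=
    PseudoRiemannianMetric.riemVolume_eq hg
  rw [← hV] at hmass ⊢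
  haveI : IsFiniteMeasure g.riemVolume := ⟨g.riemVolume_univ_lt_top⟩
  have hVolpos : 0 < (g.riemVolume Set.univ).toReal :=
    ENNReal.toReal_pos (PseudoRiemannianMetric.riemVolume_univ_pos hg).ne'
      g.riemVolume_univ_lt_top.ne
  have hε1 : 0 < 1 + ε := by linarith
  -- the regularised density `v/(1+ε)`, `v = w² + ε`, and its logarithm `φ`
  set v : M → ℝ := fun y ↦ w y ^ 2 + ε with hv_def
  have hvpos : ∀ y, 0 < v y := fun y ↦ by positivity
  set φ : M → ℝ := fun y ↦ Real.log (v y) - Real.log (1 + ε) with hφ_def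
  have hv : ContMDiff (𝓡 4) 𝓘(ℝ, ℝ) ∞ v :=
    ((contDiff_id.pow 2).add contDiff_const).comp_contMDiff hw
  have hφ : ContMDiff (𝓡 4) 𝓘(ℝ, ℝ) ∞ φ := by
    have h1 : ContDiff ℝ ∞ (fun t : ℝ ↦ Real.log (t ^ 2 + ε) - Real.log (1 + ε)) :=
      (((contDiff_id.pow 2).add contDiff_const).log
        (fun t ↦ (by positivity : (0 : ℝ) < id t ^ 2 + ε).ne')).sub contDiff_const
    exact h1.comp_contMDiff hw
  have hexpφ : ∀ y, Real.exp (φ y) = v y / (1 + ε) := fun y ↦ by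
    show Real.exp (Real.log (v y) - Real.log (1 + ε)) = _
    rw [Real.exp_sub, Real.exp_log (hvpos y), Real.exp_log hε1]
  have hφlog : ∀ y, φ y = Real.log (v y / (1 + ε)) := fun y ↦ by
    show Real.log (v y) - Real.log (1 + ε) = _
    rw [Real.log_div (hvpos y).ne' hε1.ne']
  -- integrability of the continuous integrands on the closed manifold
  have hwc : Continuous w := hw.continuous
  have hw2int : Integrable (fun x ↦ w x ^ 2) g.riemVolume := g.integrable_of_continuous (hwc.pow 2)
  -- the mass of `e^{φ}` is `Vol`
  have hmassφ : ∫ x, Real.exp (φ x) ∂g.riemVolume = (g.riemVolume Set.univ).toReal := by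
    simp_rw [hexpφ]
    rw [integral_div]
    simp only [hv_def]
    rw [integral_add hw2int (integrable_const ε), integral_const, smul_eq_mul, hmass,
      measureReal_def, div_eq_iff hε1.ne']
    ring
  -- the hypothesis at `K = 3`
  have key := hEE M g hg 3 (by norm_num) hRic φ hφ hmassφ
  -- the pointwise gradient bound `|∇φ|² e^φ ≤ 4 |∇w|²`
  have hgrad : ∀ x, g.gradSq φ x * Real.exp (φ x) ≤ 4 * g.gradSq w x := by
    intro x
    have hwd : MDifferentiableAt (𝓡 4) 𝓘(ℝ, ℝ) w x := hw.mdifferentiableAt (by simp)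
    have hvd : MDifferentiableAt (𝓡 4) 𝓘(ℝ, ℝ) v x := hv.mdifferentiableAt (by simp)
    have hh : HasDerivAt (fun t ↦ Real.log t - Real.log (1 + ε)) (v x)⁻¹ (v x) :=
      (Real.hasDerivAt_log (hvpos x).ne').sub_const _
    have h1 : g.gradSq φ x = (v x)⁻¹ ^ 2 * g.gradSq v x := by
      have := g.gradSq_real_comp (h := fun t ↦ Real.log t - Real.log (1 + ε)) hh hvd
      rw [show φ = (fun t ↦ Real.log t - Real.log (1 + ε)) ∘ v from rfl, this]
    have h2 : g.gradSq v x = 4 * w x ^ 2 * g.gradSq w x := g.gradSq_sq_add_const ε hwd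
    have hG : 0 ≤ g.gradSq w x := g.gradSq_nonneg hg w x
    have hvx : 0 < v x := hvpos x
    rw [h1, h2, hexpφ]
    have h3 : (v x)⁻¹ ^ 2 * (4 * w x ^ 2 * g.gradSq w x) * (v x / (1 + ε)) =
        4 * g.gradSq w x * (w x ^ 2 / v x) / (1 + ε) := by
      field_simp
    rw [h3]
    have h4 : w x ^ 2 / v x ≤ 1 := by
      rw [div_le_one hvx]
      show w x ^ 2 ≤ w x ^ 2 + ε
      linarith
    calc 4 * g.gradSq w x * (w x ^ 2 / v x) / (1 + ε)
        ≤ 4 * g.gradSq w x * (w x ^ 2 / v x) := div_le_self (by positivity) (by linarith)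
      _ ≤ 4 * g.gradSq w x * 1 := by gcongr
      _ = 4 * g.gradSq w x := mul_one _
  -- integrate the gradient bound
  have hγc : Continuous fun x ↦ g.gradSq φ x * Real.exp (φ x) :=
    (contMDiff_gradSq g hφ).continuous.mul (Real.continuous_exp.comp hφ.continuous)
  have hGc : Continuous (g.gradSq w) := (contMDiff_gradSq g hw).continuous
  have hA : ∫ x, g.gradSq φ x * Real.exp (φ x) ∂g.riemVolume ≤
      4 * ∫ x, g.gradSq w x ∂g.riemVolume := by
    rw [← integral_const_mul]
    exact integral_mono (g.integrable_of_continuous hγc)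
      ((g.integrable_of_continuous hGc).const_mul 4) hgrad
  have hA0 : 0 ≤ ∫ x, g.gradSq φ x * Real.exp (φ x) ∂g.riemVolume :=
    integral_nonneg fun x ↦ mul_nonneg (g.gradSq_nonneg hg φ x) (Real.exp_pos _).le
  -- compare the right-hand sides
  have hR : 2 * Real.log (1 + (∫ x, g.gradSq φ x * Real.exp (φ x) ∂g.riemVolume)
        / (4 * 3 * (g.riemVolume Set.univ).toReal)) ≤
      2 * Real.log (1 + (∫ x, g.gradSq w x ∂g.riemVolume)
        / (3 * (g.riemVolume Set.univ).toReal)) := by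
    have h1 : (∫ x, g.gradSq φ x * Real.exp (φ x) ∂g.riemVolume)
          / (4 * 3 * (g.riemVolume Set.univ).toReal) ≤
        (∫ x, g.gradSq w x ∂g.riemVolume) / (3 * (g.riemVolume Set.univ).toReal) := by
      rw [div_le_div_iff₀ (by positivity) (by positivity)]
      nlinarith [mul_le_mul_of_nonneg_right hA
        (by positivity : (0 : ℝ) ≤ 3 * (g.riemVolume Set.univ).toReal)]
    have h0 : 0 < 1 + (∫ x, g.gradSq φ x * Real.exp (φ x) ∂g.riemVolume)
        / (4 * 3 * (g.riemVolume Set.univ).toReal) := by positivity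
    gcongr
  -- the left-hand side is the regularised entropy
  have hL : ∫ x, φ x * Real.exp (φ x) ∂g.riemVolume =
      ∫ x, (w x ^ 2 + ε) / (1 + ε) * Real.log ((w x ^ 2 + ε) / (1 + ε)) ∂g.riemVolume := by
    refine integral_congr_ae (ae_of_all _ fun x ↦ ?_)
    show φ x * Real.exp (φ x) = (w x ^ 2 + ε) / (1 + ε) * Real.log ((w x ^ 2 + ε) / (1 + ε))
    rw [hexpφ, hφlog, mul_comm]
  rw [← hL]
  exact key.trans hR

/-- **STUB B3b `stub_entropyEnergy_of_positive` of line `curvature-dimension-entropy-floor` —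
`EntropyEnergyPositive → EntropyEnergyCD34`: from positive densities to `w²` by regularisation.**
Assume the curvature–dimension entropy–energy inequality for smooth POSITIVE densities on closed
connected Riemannian `4`-manifolds (`Ric ≥ K g`, `K > 0`, `∫ e^φ dV = Vol` ⇒
`(1/Vol)∫ φ e^φ dV ≤ 2 log (1 + ∫|∇φ|² e^φ dV/(4K Vol))`). Then on every closed connected
Riemannian `4`-manifold with `Ric ≥ 3g`, for every smooth `w` with `∫ w² dV = Vol`:
`(1/Vol) ∫ w² log w² dV ≤ 2 log (1 + ∫ |∇w|² dV/(3 Vol))` (EE(3,4), Bakry–Gentil–Ledoux 2014 §6,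
Bakry–Bolley–Gentil arXiv:1412.5165 eq. (4.1) with `ρ = 3`, `n = 4`). Proof: the regularised
inequality `entropyEnergy_regularised` at `ε = 1/(n+1)` and dominated convergence
(`tendsto_integral_regularised_mul_log`, `w²` is bounded on the compact manifold and the
Riemannian measure is finite), then `le_of_tendsto'`. [folklore] -/
theorem stub_entropyEnergy_of_positive :
    (∀ (M : Type) [TopologicalSpace M] [T2Space M] [SecondCountableTopology M]
      [ChartedSpace (EuclideanSpace ℝ (Fin 4)) M] [IsManifold (𝓡 4) ∞ M] [CompactSpace M] [T3Space M]
      [MeasurableSpace M] [BorelSpace M] [ConnectedSpace M]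
      (g : PseudoRiemannianMetric (𝓡 4) ∞ (EuclideanSpace ℝ (Fin 4)) (TangentSpace (𝓡 4) : M → Type _))
      [g.HasLeviCivita] (_hg : g.IsRiemannian) (K : ℝ), 0 < K →
      (∀ (y : M) (X : TangentSpace (𝓡 4) y), K * g.val y X X ≤ g.ricci y X X) →
      ∀ φ : M → ℝ, ContMDiff (𝓡 4) 𝓘(ℝ, ℝ) ∞ φ →
        ∫ x, Real.exp (φ x) ∂g.riemVolume = (g.riemVolume Set.univ).toReal →
        (∫ x, φ x * Real.exp (φ x) ∂g.riemVolume) / (g.riemVolume Set.univ).toReal ≤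
          2 * Real.log (1 + (∫ x, g.gradSq φ x * Real.exp (φ x) ∂g.riemVolume)
            / (4 * K * (g.riemVolume Set.univ).toReal))) →
    ∀ (M : Type) [TopologicalSpace M] [T2Space M] [SecondCountableTopology M]
      [ChartedSpace (EuclideanSpace ℝ (Fin 4)) M] [IsManifold (𝓡 4) ∞ M] [CompactSpace M] [T3Space M]
      [MeasurableSpace M] [BorelSpace M] [ConnectedSpace M]
      (g : PseudoRiemannianMetric (𝓡 4) ∞ (EuclideanSpace ℝ (Fin 4)) (TangentSpace (𝓡 4) : M → Type _))
      [g.HasLeviCivita] (hg : g.IsRiemannian),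
      (∀ (x : M) (v : TangentSpace (𝓡 4) x), 3 * g.val x v v ≤ g.ricci x v v) →
      ∀ w : M → ℝ, ContMDiff (𝓡 4) 𝓘(ℝ, ℝ) ∞ w →
        ∫ x, w x ^ 2 ∂(riemannianMeasure (g.toContMDiffRiemannianMetric hg))
          = (riemannianMeasure (g.toContMDiffRiemannianMetric hg) Set.univ).toReal →
        (∫ x, w x ^ 2 * Real.log (w x ^ 2) ∂(riemannianMeasure (g.toContMDiffRiemannianMetric hg)))
          / (riemannianMeasure (g.toContMDiffRiemannianMetric hg) Set.univ).toReal ≤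
        2 * Real.log (1 + (∫ x, g.gradSq w x ∂(riemannianMeasure (g.toContMDiffRiemannianMetric hg)))
            / (3 * (riemannianMeasure (g.toContMDiffRiemannianMetric hg) Set.univ).toReal)) := by
  intro hEE M _ _ _ _ _ _ _ _ _ _ g _ hg hRic w hw hmass
  haveI : IsFiniteMeasure (riemannianMeasure (g.toContMDiffRiemannianMetric hg)) :=
    isFiniteMeasure_riemannianMeasure _
  -- `w²` is bounded on the compact manifold
  obtain ⟨S, hS⟩ : ∃ S : ℝ, ∀ x, w x ^ 2 ≤ S := by
    obtain ⟨C, hC⟩ := isCompact_univ.exists_bound_of_continuousOn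
      ((hw.continuous.pow 2).continuousOn (s := (univ : Set M)))
    exact ⟨C, fun x ↦ (le_abs_self _).trans (by simpa [Real.norm_eq_abs] using hC x (mem_univ x))⟩
  -- the regularised entropies converge ...
  have hlim := tendsto_integral_regularised_mul_log
    (riemannianMeasure (g.toContMDiffRiemannianMetric hg))
    ((hw.continuous.pow 2).aestronglyMeasurable) (fun x ↦ sq_nonneg (w x)) hS
  -- ... and each of them obeys the bound
  refine le_of_tendsto' (hlim.div_const _) fun n ↦ ?_
  exact entropyEnergy_regularised hEE M g hg hRic w hw hmass (ε := 1 / ((n : ℝ) + 1))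
    Nat.one_div_pos_of_nat

end Summit.SmoothPoincare4.SmoothPoincare4.Theorems

end
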